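import Summits.QuantumAdvantage.AdviceFreeQNC0.AffBells22Geo
import HarnessLib

/-!
# Cell qa-qnc0, the GEOMETRIC MODEL of plan S2 (ROUND-21 §1): the KERNEL FORMULA — planner qa-qnc0-p1 g22,
`Sketch22.lean` §1 (`GeoKernelFormula`, stated VERBATIM in `AffBells22Geo.lean`)

Support for crux `RingDenseResidualLt3` (stmt-QuantumAdvantage-22907), route `DWalkThree`, rung candidate
`RingFrameAffineLt3`.  PROVED here (0 sorry): **`geoKernelFormula : GeoKernelFormula`**,
`2·3^s·Σ_{u ∈ 𝔽₃^m} (−1)^{hits(u)} = 3^m · Σ_{ξ ∈ 𝔽₃^s, ξM = 0} (−2)^{wt ξ}·(2[⟨ξ,ρ⟩ = 0] − [⟨ξ,ρ⟩ ≠ 0])`: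
the bias of an affine hyperplane system under the uniform measure of `𝔽₃^m` is carried entirely by the LEFT KERNEL of its
coefficient matrix.  Proof: expand each row sign in the characters of `𝔽₃`
(`TwoModuli.sign_ite_eq_sum_stdAddChar`, coefficients `c_0 = 1/3`, `c_{±1} = −2/3`, so `Π_k c_{ξ_k} = 3^{−s}(−2)^{wt ξ}`,
`prod_rowCoef_eq`), multiply out (`neg_one_pow_geoHits_eq`), sum over the points with orthogonality on `𝔽₃^m`
(`TwoModuli.sum_stdAddChar_dot_eq_ite`: only `ξM = 0` survives, `sum_neg_one_pow_geoHits_eq`), and symmetrise `ξ ↦ −ξ`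
(`kerSum_neg_symm`, `ω^a + ω^{−a} = 2[a=0] − [a≠0]`, `stdAddChar_add_stdAddChar_neg`).

WHAT THIS IS NOT: nothing about the crux; GEO-REL (`GeoRelSpan`/`GeoRelOnlyParallel`) is not treated.
-/

namespace Summit.QuantumAdvantage.AdviceFreeQNC0

open Finset
open Literature.Computability.MetaComplexity

namespace AffBells22

variable {m s : ℕ}

/-! ## Characters of `𝔽₃`: two more small facts -/

/-- Sums over `𝔽₃`, explicitly (complex values). -/
theorem sum_zmod3_complex (f : ZMod 3 → ℂ) : ∑ a, f a = f 0 + f 1 + f 2 := by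
  have h : (univ : Finset (ZMod 3)) = {0, 1, 2} := by decide
  rw [h, sum_insert (by decide), sum_insert (by decide), sum_singleton, add_assoc]

/-- `ω^a + ω^{−a} = 2·[a = 0] − [a ≠ 0]` on `𝔽₃` (from `1 + ω + ω² = 0`). -/
theorem stdAddChar_add_stdAddChar_neg (a : ZMod 3) :
    (ZMod.stdAddChar a : ℂ) + (ZMod.stdAddChar (-a) : ℂ) = if a = 0 then 2 else -1 := by
  have h2 : ∀ b : ZMod 3, b * 2 = -b := by decide
  have h := AffBells21.sum_stdAddChar_three a
  rw [sum_zmod3_complex] at h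
  rw [mul_zero, AddChar.map_zero_eq_one, mul_one, h2 a] at h
  by_cases ha : a = 0
  · subst ha
    rw [neg_zero, AddChar.map_zero_eq_one, if_pos rfl]
    norm_num
  · rw [if_neg ha] at h ⊢
    linear_combination h

/-! ## The kernel formula -/

/-- The row coefficient `c_t = [t = 0] − 2/3`, i.e. `1/3` at `t = 0` and `−2/3` otherwise. -/
theorem rowCoef_eq (t : ZMod 3) :
    ((if t = 0 then (1 : ℂ) else 0) - 2 * (((3 : ℕ) : ℂ))⁻¹) = (3 : ℂ)⁻¹ * (if t = 0 then 1 else -2) := by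
  push_cast
  split_ifs <;> norm_num

/-- The coefficient product: `Π_k c_{ξ_k} = 3^{−s} (−2)^{wt ξ}`. -/
theorem prod_rowCoef_eq (ξ : Fin s → ZMod 3) :
    ∏ k : Fin s, ((if ξ k = 0 then (1 : ℂ) else 0) - 2 * (((3 : ℕ) : ℂ))⁻¹)
      = (3 : ℂ)⁻¹ ^ s * (-2 : ℂ) ^ (univ.filter fun k : Fin s => ξ k ≠ 0).card := by
  simp_rw [rowCoef_eq]
  rw [prod_mul_distrib, prod_const, card_univ, Fintype.card_fin]
  congr 1
  rw [prod_ite, prod_const_one, one_mul, prod_const]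

/-- Pointwise expansion of the sign in the characters of `𝔽₃^m`:
`(−1)^{hits(u)} = Σ_ξ (Π_k c_{ξ_k}) ω^{−⟨ξ,ρ⟩} ω^{⟨u, ξM⟩}`. -/
theorem neg_one_pow_geoHits_eq (M : Fin s → Fin m → ZMod 3) (ρ : Fin s → ZMod 3) (u : Fin m → ZMod 3) :
    (-1 : ℂ) ^ geoHits m s M ρ u
      = ∑ ξ : Fin s → ZMod 3, (∏ k : Fin s, ((if ξ k = 0 then (1 : ℂ) else 0) - 2 * (((3 : ℕ) : ℂ))⁻¹))
          * ((ZMod.stdAddChar (-(∑ k : Fin s, ξ k * ρ k)) : ℂ)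
            * (ZMod.stdAddChar (∑ i : Fin m, u i * (∑ k : Fin s, ξ k * M k i)) : ℂ)) := by
  unfold geoHits
  rw [TwoModuli.neg_one_pow_card_filter_eq_prod]
  have hk : ∀ k : Fin s, (if (∑ i : Fin m, M k i * u i) = ρ k then (-1 : ℂ) else 1)
      = ∑ t : ZMod 3, ((if t = 0 then (1 : ℂ) else 0) - 2 * (((3 : ℕ) : ℂ))⁻¹)
          * (ZMod.stdAddChar (t * ((∑ i : Fin m, M k i * u i) - ρ k)) : ℂ) := by
    intro k
    rw [← TwoModuli.sign_ite_eq_sum_stdAddChar ((∑ i : Fin m, M k i * u i) - ρ k)]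
    simp only [sub_eq_zero]
  simp_rw [hk]
  rw [Fintype.prod_sum]
  refine sum_congr rfl fun ξ _ => ?_
  rw [prod_mul_distrib, ← AffBells21.stdAddChar_sum_eq_prod, ← AddChar.map_add_eq_mul]
  congr 2
  have h1 : ∑ k : Fin s, ξ k * ((∑ i : Fin m, M k i * u i) - ρ k)
      = (∑ k : Fin s, ξ k * (∑ i : Fin m, M k i * u i)) - ∑ k : Fin s, ξ k * ρ k := by
    rw [← sum_sub_distrib]
    exact sum_congr rfl fun k _ => by ring
  have h2 : ∑ k : Fin s, ξ k * (∑ i : Fin m, M k i * u i) = ∑ i : Fin m, u i * (∑ k : Fin s, ξ k * M k i) := by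
    simp_rw [mul_sum]
    rw [sum_comm]
    exact sum_congr rfl fun i _ => sum_congr rfl fun k _ => by ring
  rw [h1, h2]
  ring

/-- Summing over the points: `Σ_u (−1)^{hits(u)} = 3^m Σ_{ξM = 0} (Π_k c_{ξ_k}) ω^{−⟨ξ,ρ⟩}`. -/
theorem sum_neg_one_pow_geoHits_eq (M : Fin s → Fin m → ZMod 3) (ρ : Fin s → ZMod 3) :
    ∑ u : Fin m → ZMod 3, (-1 : ℂ) ^ geoHits m s M ρ u
      = (3 : ℂ) ^ m * ∑ ξ : Fin s → ZMod 3,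
          (if (∀ i : Fin m, (∑ k : Fin s, ξ k * M k i) = 0) then
            (∏ k : Fin s, ((if ξ k = 0 then (1 : ℂ) else 0) - 2 * (((3 : ℕ) : ℂ))⁻¹))
              * (ZMod.stdAddChar (-(∑ k : Fin s, ξ k * ρ k)) : ℂ) else 0) := by
  simp_rw [neg_one_pow_geoHits_eq]
  rw [sum_comm, mul_sum]
  refine sum_congr rfl fun ξ _ => ?_
  simp_rw [← mul_assoc]
  rw [← mul_sum, TwoModuli.sum_stdAddChar_dot_eq_ite (fun i : Fin m => ∑ k : Fin s, ξ k * M k i)]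
  have hiff : ((fun i : Fin m => ∑ k : Fin s, ξ k * M k i) = 0) ↔ (∀ i : Fin m, (∑ k : Fin s, ξ k * M k i) = 0) := by
    constructor
    · intro h i; exact congrFun h i
    · intro h; funext i; exact h i
  by_cases hker : ∀ i : Fin m, (∑ k : Fin s, ξ k * M k i) = 0
  · rw [if_pos (hiff.mpr hker), if_pos hker]
    push_cast
    ring
  · rw [if_neg (fun h => hker (hiff.mp h)), if_neg hker, mul_zero, mul_zero]

/-- The kernel sum with phases `ω^{−⟨ξ,ρ⟩}` equals the one with phases `ω^{+⟨ξ,ρ⟩}` (substitute `ξ ↦ −ξ`). -/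
theorem kerSum_neg_symm (M : Fin s → Fin m → ZMod 3) (ρ : Fin s → ZMod 3) :
    ∑ ξ : Fin s → ZMod 3, (if (∀ i : Fin m, (∑ k : Fin s, ξ k * M k i) = 0) then
        (-2 : ℂ) ^ (univ.filter fun k : Fin s => ξ k ≠ 0).card * (ZMod.stdAddChar (-(∑ k : Fin s, ξ k * ρ k)) : ℂ)
        else 0)
      = ∑ ξ : Fin s → ZMod 3, (if (∀ i : Fin m, (∑ k : Fin s, ξ k * M k i) = 0) then
        (-2 : ℂ) ^ (univ.filter fun k : Fin s => ξ k ≠ 0).card * (ZMod.stdAddChar (∑ k : Fin s, ξ k * ρ k) : ℂ)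
        else 0) := by
  rw [← Equiv.sum_comp (Equiv.neg (Fin s → ZMod 3))]
  refine sum_congr rfl fun ξ _ => ?_
  have hneg : ∀ k, (Equiv.neg (Fin s → ZMod 3)) ξ k = -ξ k := fun k => rfl
  simp only [hneg, neg_mul, sum_neg_distrib, neg_eq_zero, neg_neg, ne_eq]

/-- **KERNEL FORMULA, PROVED**: `2·3^s·geoBiasNum = 3^m·geoKerSum`. -/
theorem geoKernelFormula : GeoKernelFormula := by
  intro m s M ρ
  -- complex form of both sides
  have hL : ((geoBiasNum m s M ρ : ℤ) : ℂ) = ∑ u : Fin m → ZMod 3, (-1 : ℂ) ^ geoHits m s M ρ u := by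
    unfold geoBiasNum; push_cast; rfl
  have hR : ((geoKerSum m s M ρ : ℤ) : ℂ) = ∑ ξ : Fin s → ZMod 3,
      (if (∀ i : Fin m, (∑ k : Fin s, ξ k * M k i) = 0) then
        (-2 : ℂ) ^ (univ.filter fun k : Fin s => ξ k ≠ 0).card
          * (if (∑ k : Fin s, ξ k * ρ k) = 0 then (2 : ℂ) else -1) else 0) := by
    unfold geoKerSum; push_cast; rfl
  -- the character computation
  set Z : ℂ := ∑ ξ : Fin s → ZMod 3, (if (∀ i : Fin m, (∑ k : Fin s, ξ k * M k i) = 0) then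
      (-2 : ℂ) ^ (univ.filter fun k : Fin s => ξ k ≠ 0).card * (ZMod.stdAddChar (-(∑ k : Fin s, ξ k * ρ k)) : ℂ)
      else 0) with hZ
  have hsum : (3 : ℂ) ^ s * ∑ u : Fin m → ZMod 3, (-1 : ℂ) ^ geoHits m s M ρ u = (3 : ℂ) ^ m * Z := by
    rw [sum_neg_one_pow_geoHits_eq, ← mul_assoc, mul_comm ((3 : ℂ) ^ s), mul_assoc, hZ, mul_sum]
    congr 1
    refine sum_congr rfl fun ξ _ => ?_
    split_ifs with h
    · rw [prod_rowCoef_eq, ← mul_assoc, ← mul_assoc, ← mul_pow,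
        mul_inv_cancel₀ (by norm_num : (3 : ℂ) ≠ 0), one_pow, one_mul]
    · rw [mul_zero]
  have hZ2 : 2 * Z = ∑ ξ : Fin s → ZMod 3, (if (∀ i : Fin m, (∑ k : Fin s, ξ k * M k i) = 0) then
      (-2 : ℂ) ^ (univ.filter fun k : Fin s => ξ k ≠ 0).card
        * (if (∑ k : Fin s, ξ k * ρ k) = 0 then (2 : ℂ) else -1) else 0) := by
    rw [two_mul]
    nth_rewrite 2 [hZ]
    rw [kerSum_neg_symm, hZ, ← sum_add_distrib]
    refine sum_congr rfl fun ξ _ => ?_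
    by_cases h : ∀ i : Fin m, (∑ k : Fin s, ξ k * M k i) = 0
    · simp only [if_pos h]
      rw [← mul_add, add_comm ((ZMod.stdAddChar (-(∑ k : Fin s, ξ k * ρ k)) : ℂ)), stdAddChar_add_stdAddChar_neg]
    · simp only [if_neg h, add_zero]
  have hC : (2 : ℂ) * (3 : ℂ) ^ s * ((geoBiasNum m s M ρ : ℤ) : ℂ) = (3 : ℂ) ^ m * ((geoKerSum m s M ρ : ℤ) : ℂ) := by
    rw [hL, hR, mul_assoc, hsum, ← hZ2]
    ring
  exact_mod_cast hC

end AffBells22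

end Summit.QuantumAdvantage.AdviceFreeQNC0
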